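import Literature.Geometry.Riemannian.ShrinkerDistanceComparison
import Summits.SmoothPoincare4.SmoothPoincare4.Theses.EntropyRung
import HarnessLib

/-!
# Stub X_A `stub_directionalComparison` of line `collapsed-ends-usc` — crux `EntropyRung.NoncompactShrinkerGap`
# (stmt-SmoothPoincare4-10868), skeleton v6

The registered signature (= the skeleton's `DirectionalComparison`, unfolded): Zhang's weighted
Laplacian comparison for `d(p, ·)` along geodesic directions on a complete connected gradient
shrinking Ricci soliton `Ric + Hess f = g/2` (Z.-H. Zhang, Proc. AMS 137 (2009), Prop. 2.2 (ii) and
proof of Thm. 1.3, Step 1), PROVED in Literature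
(`Literature/Geometry/Riemannian/ShrinkerDistanceComparison{Cutoff,Datum,}.lean`,
`Zhang2009.directionalComparison_core`); here specialised to the fact's binder (`𝓡 n`,
`finrank ℝ (EuclideanSpace ℝ (Fin n)) = n`, the regularity instances of the smooth Levi-Civita
connection). The normalisation hypothesis `R + |∇f|² = f` is not used. With the sibling stub X_B
(`stub_minimumPrinciple`, the localised minimum principle) it proves `R ≥ 0`
(`stub_scalarCurvatureNonneg` of the skeleton = Literature `shrinkerScalarCurvature_nonneg`).
-/

noncomputable section

set_option linter.dupNamespace false

open Set Filter
open scoped Manifold ContDiff Topology ENNReal NNReal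

namespace Summit.SmoothPoincare4.SmoothPoincare4.Theorems.NoncompactShrinkerGapDirectionalComparison

open Literature.Geometry.Lorentzian Literature.Geometry.Riemannian

/-- **Stub X_A `stub_directionalComparison` of line `collapsed-ends-usc`** (skeleton v6 of crux
`EntropyRung.NoncompactShrinkerGap`, stmt-SmoothPoincare4-10868): the registered signature, i.e.
the skeleton's `DirectionalComparison` unfolded — Zhang's weighted Laplacian comparison for
`d(p, ·)` along geodesic directions on a complete connected gradient shrinker (the normalisation
`R + |∇f|² = f` is not used). From `directionalComparison_core` with the regularity instances of
the smooth Levi-Civita connection and `finrank ℝ (EuclideanSpace ℝ (Fin n)) = n`.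
[cite: Zhang2009, Prop. 2.2 (ii) and proof of Thm. 1.3, Step 1] -/
theorem stub_directionalComparison : ∀ (n : ℕ) (M : Type) [TopologicalSpace M] [T2Space M] [SecondCountableTopology M] [ChartedSpace (EuclideanSpace ℝ (Fin n)) M] [IsManifold (𝓡 n) ∞ M] [ConnectedSpace M] [T3Space M] [MeasurableSpace M] [BorelSpace M] (g : PseudoRiemannianMetric (𝓡 n) ∞ (EuclideanSpace ℝ (Fin n)) (TangentSpace (𝓡 n) : M → Type _)) [g.HasLeviCivita] (f : M → ℝ) (hg : g.IsRiemannian), (∀ (x : M) (r : NNReal), IsCompact {y : M | g.edist hg x y ≤ r}) → ContMDiff (𝓡 n) 𝓘(ℝ, ℝ) ∞ f → (∀ (x : M) (X Y : TangentSpace (𝓡 n) x), g.ricci x X Y + g.hessian f x X Y = (1 / 2 : ℝ) * g.val x X Y) → (∀ x : M, g.scalarCurvature x + g.gradSq f x = f x) → ∀ p : M, ∃ C : ℝ, ∀ x₀ : M, 1 ≤ (g.edist hg p x₀).toReal → ∃ (k : ℕ) (e : Option (Fin k) → TangentSpace (𝓡 n) x₀) (q : Option (Fin k) → ℝ), Fintype.card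 (Option (Fin k)) = n ∧ (∀ o o', g.val x₀ (e o) (e o') = if o = o' then 1 else 0) ∧ 2 * (∑ o, q o) - mvfderiv (𝓡 n) f x₀ (e none) ≤ C ∧ ∀ o, ∀ᶠ s in 𝓝 (0 : ℝ), (g.edist hg p (expMap g.leviCivita x₀ (s • e o))).toReal ≤ (g.edist hg p x₀).toReal + (if o = none then s else 0) + q o * s ^ 2 := by
  intro n M _ _ _ _ _ _ _ _ _ g _ f hg hcpt hf hsol _ p
  have hk1 : ((1 : ℕ∞) : ℕ∞ω) + 1 ≤ (∞ : ℕ∞ω) := by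
    rw [show ((1 : ℕ∞) : ℕ∞ω) + 1 = 2 by norm_num]
    exact WithTop.coe_le_coe.2 le_top
  haveI : CovariantDerivative.ContMDiffCovariantDerivative g.leviCivita 1 :=
    ⟨g.isLocallyContMDiff_leviCivita_holds 1 hk1 univ isOpen_univ⟩
  haveI : CovariantDerivative.ContMDiffCovariantDerivative g.leviCivita ∞ :=
    ⟨g.isLocallyContMDiff_leviCivita_holds ⊤ (le_of_eq rfl) univ isOpen_univ⟩
  obtain ⟨C, hC⟩ := Zhang2009.directionalComparison_core g hg hcpt hf hsol p
  refine ⟨C, fun x₀ hx₀ ↦ ?_⟩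
  obtain ⟨k, e, q, hcard, hon, hle, hbar⟩ := hC x₀ hx₀
  refine ⟨k, e, q, ?_, hon, hle, hbar⟩
  rw [hcard, finrank_euclideanSpace_fin]

end Summit.SmoothPoincare4.SmoothPoincare4.Theorems.NoncompactShrinkerGapDirectionalComparison

end
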